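import Literature.NumberTheory.Rogawski1990.ArchCentralLimitFormulaOfSigns      -- ★ p843487 (this seat): `archCentralLimitFormulaRankTwo_of_signs`
import Mathlib.NumberTheory.NumberField.CMField
import Mathlib.NumberTheory.Cyclotomic.Basic
import Mathlib.NumberTheory.NumberField.Cyclotomic.Embeddings
import HarnessLib

/-!
# ROAD A, brick (G) closed form: the letter `ArchCentralLimitFormulaRankTwo` at EVERY field follows from the letter at CM FIELDS — the adapter between the in-house (CM-bound) road and
# the registered stubs `stub_L21` ∕ `stub_ArchCentralLimitU21` (typed `∀ (L : Type) [Field L]`) (LEAD F0P3a-plan (g10) WORDS T9-15 (3) ∕ T9-16 (2); Rogawski 1990 §8.4 p. 126)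

Topic `NumberTheory/Rogawski1990`; namespace `Literature.NumberTheory.Rogawski1990`.  THEOREMS ONLY (no `def`, no instance, no notation, no axiom, no named fact, no `sorry`).
Cell `pub/hodgecm-mathlib`, ENGINE T1 (crux H413 = `stmt-HodgeConjecture-24833`); author A-p18 (g25), 2026-09-01.

**`archCentralLimitFormulaRankTwo_of_cm`**: `(∀ (L₀ : Type) [Field L₀] [NumberField L₀] [IsCMField L₀] (α₀) (w₀), ArchCentralLimitFormulaRankTwo L₀ α₀ w₀) → ∀ (L : Type) [Field L] (α) (w),
ArchCentralLimitFormulaRankTwo L α w` — so the day ROAD A proves the letter in its natural CM generality (its (J-nc) input ★ `archLimitFormulaNoncompactWall_holds` is CM-bound), `stub_L21` closes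
BY NAME with ONE application, ZERO closer events.  PROOF: inside the letter at `(L, α, w)` the frame entries `σ_w α_i` are real and non-zero; take the CM field `L₀ = ℚ(ζ₅)` (Mathlib
`IsCyclotomicExtension.Rat.isCMField`), any complex place `w₀` (totally complex), and the SIGN frame `α₀_i = ±1 ∈ L₀` with the signs of `re σ_w α_i`; then ★ `archCentralLimitFormulaRankTwo_of_signs`.
Also the one-pattern form `archCentralLimitFormulaRankTwo_of_cm_signs` (hypothesis only at `(ℚ(ζ₅), ±1-frames)`), which is what ROAD A literally has to produce: the letter at the two
indefinite `±1`-patterns up to ★ COLLAPSE.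
HONEST LABEL: an adapter; proves nothing about the letter itself; HC_CM is proved only modulo the printed citations until rung 0 closes.

## References
* [Rogawski1990] J. D. Rogawski, *Automorphic Representations of Unitary Groups in Three Variables*, Ann. of Math. Stud. 123 (1990), §8.4 pp. 126–127.
* [PlatonovRapinchuk1994] V. Platonov, A. Rapinchuk, *Algebraic Groups and Number Theory* (1994), §2.3.
-/

set_option autoImplicit false

noncomputable section

open NumberField NumberField.InfinitePlace

namespace Literature.NumberTheory.Rogawski1990

section OfCM

/-- **THE LETTER AT EVERY FIELD FROM THE LETTER AT THE `±1`-FRAMES OF `ℚ(ζ₅)`.**  If `ArchCentralLimitFormulaRankTwo (ℚ(ζ₅)) s w₀` holds for every sign vector `s : Fin 3 → ℚ(ζ₅)` with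
`s i ∈ {1, −1}` and every complex place `w₀`, then the letter holds at every `(L, α, w)` (★ `archCentralLimitFormulaRankTwo_of_signs` with the sign frame of `re σ_w α`).
[cite: Rogawski1990, §8.4 pp. 126–127] [cite: PlatonovRapinchuk1994, §2.3] -/
theorem archCentralLimitFormulaRankTwo_of_cm_signs
    (h₀ : ∀ (s : Fin 3 → CyclotomicField 5 ℚ), (∀ i, s i = 1 ∨ s i = -1) →
      ∀ w₀ : {w : InfinitePlace (CyclotomicField 5 ℚ) // IsComplex w}, ArchCentralLimitFormulaRankTwo (CyclotomicField 5 ℚ) s w₀)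
    (L : Type) [Field L] (α : Fin 3 → L) (w : {w : InfinitePlace L // IsComplex w}) : ArchCentralLimitFormulaRankTwo L α w := by
  intro _ _ _ _ hα hreal hind ν _ _
  classical
  -- a complex place of the CM field `ℚ(ζ₅)`
  haveI : IsCMField (CyclotomicField 5 ℚ) :=   -- Mathlib; cf. `Summit.HodgeConjecture.CorCM.AndreRiemann.isCMField_cyclotomicField_five` (Summits side, not importable here)
    @IsCyclotomicExtension.Rat.isCMField (CyclotomicField 5 ℚ) _ _ {5} ⟨5, rfl, by norm_num⟩ (CyclotomicField.isCyclotomicExtension 5 ℚ)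
  obtain ⟨v₀⟩ : Nonempty (InfinitePlace (CyclotomicField 5 ℚ)) := inferInstance
  let w₀ : {w : InfinitePlace (CyclotomicField 5 ℚ) // IsComplex w} := ⟨v₀, IsTotallyComplex.isComplex v₀⟩
  -- the sign frame
  let s : Fin 3 → CyclotomicField 5 ℚ := fun i => if 0 < (w.1.embedding (α i)).re then 1 else -1
  have hs : ∀ i, s i = 1 ∨ s i = -1 := fun i => by
    by_cases h : 0 < (w.1.embedding (α i)).re
    · exact Or.inl (if_pos h)
    · exact Or.inr (if_neg h)
  have hre : ∀ i, (w.1.embedding (α i)).re ≠ 0 := by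
    intro i h
    apply hα i
    apply w.1.embedding.injective
    rw [map_zero]
    exact Complex.ext h (hreal i)
  have hreal₀ : ∀ i, (w₀.1.embedding (s i)).im = 0 := by
    intro i
    rcases hs i with h | h <;> simp [h]
  have hsame : ∀ i, 0 < (w.1.embedding (α i)).re * (w₀.1.embedding (s i)).re := by
    intro i
    by_cases h : 0 < (w.1.embedding (α i)).re
    · have : s i = 1 := if_pos h
      rw [this, map_one, Complex.one_re, mul_one]; exact h
    · have : s i = -1 := if_neg h
      rw [this, map_neg, map_one, Complex.neg_re, Complex.one_re]
      have hlt : (w.1.embedding (α i)).re < 0 := lt_of_le_of_ne (not_lt.1 h) (hre i)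
      nlinarith
  exact archCentralLimitFormulaRankTwo_of_signs L α w (CyclotomicField 5 ℚ) s w₀ hreal hreal₀ hsame (h₀ s hs w₀) hα hreal hind ν

/-- **THE LETTER AT EVERY FIELD FROM THE LETTER AT CM FIELDS** — the adapter between ROAD A's natural generality and the registered stubs `stub_L21` ∕ `stub_ArchCentralLimitU21`
(`∀ (L : Type) [Field L] …`). [cite: Rogawski1990, §8.4 pp. 126–127] [cite: PlatonovRapinchuk1994, §2.3] -/
theorem archCentralLimitFormulaRankTwo_of_cm
    (hCM : ∀ (L₀ : Type) [Field L₀] [NumberField L₀] [IsCMField L₀] (α₀ : Fin 3 → L₀) (w₀ : {w : InfinitePlace L₀ // IsComplex w}),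
      ArchCentralLimitFormulaRankTwo L₀ α₀ w₀)
    (L : Type) [Field L] (α : Fin 3 → L) (w : {w : InfinitePlace L // IsComplex w}) : ArchCentralLimitFormulaRankTwo L α w := by
  haveI : IsCMField (CyclotomicField 5 ℚ) :=   -- Mathlib; cf. `Summit.HodgeConjecture.CorCM.AndreRiemann.isCMField_cyclotomicField_five` (Summits side, not importable here)
    @IsCyclotomicExtension.Rat.isCMField (CyclotomicField 5 ℚ) _ _ {5} ⟨5, rfl, by norm_num⟩ (CyclotomicField.isCyclotomicExtension 5 ℚ)
  intro _ _ _ _ hα hreal hind ν _ _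
  exact archCentralLimitFormulaRankTwo_of_cm_signs (fun s _ w₀ => hCM (CyclotomicField 5 ℚ) s w₀) L α w hα hreal hind ν

end OfCM

end Literature.NumberTheory.Rogawski1990

end
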